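import Summits.SmoothPoincare4.SmoothPoincare4.Theses.SymplecticOrigami
import Summits.SmoothPoincare4.SmoothPoincare4.Theorems.SymplecticOrigamiGromovRecognitionRelEndStubFlatCutoffAux2
import Summits.SmoothPoincare4.SmoothPoincare4.Theorems.SymplecticOrigamiGromovRecognitionRelEndStubFlatCutoffAux3
import Literature.Geometry.Symplectic.AlmostComplexStructure

/-!
# Line `cross-cap-laurent`, Stub 5: Laurent decay and the tame cut-off
(stub `stub_flatCutoff` of the skeleton of crux `SymplecticOrigami.GromovRecognitionRelEnd` ≡
`SymplecticCap.GromovRecognitionRelEnd` ≡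
`Literature.Geometry.Symplectic.gromov_recognitionR4_relEnd`, item stmt-SmoothPoincare4-11009;
fourth of four files, the registered signature)

From the bi-foliation chart `σ : M ≃ₘ ℝ⁴` of the apex — split (B1), tame (B2), equal to the end
chart `ψ` coordinate-wise on the slabs `{|z₁| > R₁}`, `{|z₂| > R₁}` (B3), smooth at the wedge in
the inverted cap charts (B4)/(B5) — the theorem `stub_flatCutoff` produces a diffeomorphism
`Φ₁ : M ≃ₘ ℝ⁴` with `Φ₁ = ψ` off a compact `K₁ ⊇ K` whose pull-back of `ω₀` still tames `J`
(the input of the line's last stub, the compactly supported tame Moser argument).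

Proof (the three auxiliary files carry the analysis on `ℝ⁴`):
1. `G := σ ∘ χ → id` in `C¹` at infinity (`FlatCutoff.decay_first_factor`,
   `FlatCutoff.decay_of_smooth_at_wedge`);
2. `K` is compact (H5 at `R' = R` with H8), so `W := ψ ∘ σ⁻¹` is smooth on the open `σ(Kᶜ)`; far
   out `W = G⁻¹` is `C¹`-close to the identity (`‖W - id‖ ≤ 1/100`, `‖DW - I‖ ≤ 2/100`);
3. with a radial cut-off `θ` vanishing on a ball containing `σ(K ∪ {‖ψ‖ ≤ r})` (compact by H5)
   and `= 1` far out, `F := id + θ · (W - id)` is smooth on `ℝ⁴` with `‖DF - I‖ ≤ 3/100`, hence a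
   diffeomorphism (`FlatCutoff.exists_diffeomorph_of_norm_fderiv_sub_id_le`);
4. `Φ₁ := F ∘ σ`, `K₁ := K ∪ σ⁻¹(B̄(0, 2ρ₁))`: off `K₁`, `θ = 1` and `Φ₁ = W ∘ σ = ψ`;
5. tameness: where `F = id` near `σ x` it is (B2); elsewhere `x ∉ K`, `‖ψ x‖ > r > R₁`, and
   `dΦ₁ = (DF ∘ DG) ∘ dψ` with `‖DF ∘ DG - I‖ ≤ 1/20`, `dψ (J v) = (i ⊕ i)(dψ v)` (the hypothesis
   "`J = ψ*(i ⊕ i)` beyond `R₁`"), `dψ v ≠ 0` (as `dσ = DG ∘ dψ` is invertible), and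
   `ω₀(La, L(i⊕i)a) > 0` (`FlatCutoff.stdSymplecticForm_pos_of_norm_sub_id_le`).
The openness of the truncations (Stub 1) is not needed: both pieces of `F` live on open subsets of
`ℝ⁴` (`σ(Kᶜ)` and a ball). The hypotheses `sf`, H10 and the `sf`-tameness of `J` are carried but
not used (they are consumed by the neighbouring stubs).

References: D. McDuff, D. Salamon, *Introduction to Symplectic Topology*, 3rd ed. (2017),
Rem. 4.5.2 (viii) [McDuffSalamon2017]; C. Wendl, *Holomorphic Curves in Low Dimensions* (2018),
proof of Thm. 6.8 [Wendl2018].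
-/

noncomputable section

-- the registered namespace `Summit.SmoothPoincare4.SmoothPoincare4.Theorems…` repeats a component
set_option linter.dupNamespace false

open scoped Manifold ContDiff Topology
open Set TopologicalSpace Literature.Geometry.Kaehler Literature.Geometry.Symplectic

namespace Summit.SmoothPoincare4.SmoothPoincare4.Theorems.GromovRecognitionRelEnd.CrossCapLaurent

open FlatCutoff

/-- Model space `ℝ⁴ = ℂ²` (coordinates `0,1` = `z₁`, `2,3` = `z₂`). -/
local notation "E4" => EuclideanSpace ℝ (Fin 4)
/-- `ℝ² = ℂ`, the coordinate plane of one factor. -/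
local notation "E2" => EuclideanSpace ℝ (Fin 2)

/-! ## The stub -/

set_option maxHeartbeats 400000 in
/-- **Stub 5 of line `cross-cap-laurent` — Laurent decay and the tame cut-off.** From the
bi-foliation chart `σ : M ≃ₘ ℝ⁴` of the apex (split (B1), tame (B2), equal to `ψ` coordinate-wise
on the slabs `{|z₁| > R₁}`, `{|z₂| > R₁}` (B3), smooth at the wedge (B4)/(B5)) we build a
diffeomorphism `Φ₁ : M ≃ₘ ℝ⁴` with `Φ₁ = ψ` off a compact `K₁ ⊇ K` such that `Φ₁*ω₀` still tames
`J`.  Proof: `G := σ ∘ χ → id` in `C¹` at infinity (`decay_of_smooth_at_wedge`); in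
`σ`-coordinates `W := ψ ∘ σ⁻¹ = G⁻¹` is `C¹`-close to the identity far out, so the cut-off
`F := id + θ · (W - id)` (`θ` a smooth radial cut-off, `= 0` on a large ball containing
`σ(K ∪ {‖ψ‖ ≤ r})`, `= 1` far out, `|∇θ| ≤ 4c/ρ₁`) has `‖DF - I‖ ≤ 3/100`, hence is a
diffeomorphism of `ℝ⁴` (`exists_diffeomorph_of_norm_fderiv_sub_id_le`); `Φ₁ := F ∘ σ` equals `σ`
on the ball and `ψ` far out, `K₁ := K ∪ σ⁻¹(closed ball)`; tameness: where `F = id` it is (B2),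
elsewhere `dΦ₁ = (DF ∘ DG) dψ` with `‖DF ∘ DG - I‖ ≤ 1/20` and `dψ ∘ J = (i ⊕ i) ∘ dψ`, and
`ω₀(La, L(i⊕i)a) > 0` (`stdSymplecticForm_pos_of_norm_sub_id_le`). The hypotheses `sf`, H10 and
the `sf`-tameness of `J` are not used (they are consumed by the neighbouring stubs).
[folklore] -/
theorem stub_flatCutoff :
    ∀ (M : Type) [TopologicalSpace M] [T2Space M] [SecondCountableTopology M]
      [ChartedSpace E4 M] [IsManifold (𝓡 4) ∞ M] [ConnectedSpace M]
      (sf : MForm (𝓡 4) M ℝ 2) (K : Set M) (R : ℝ) (ψ : M → E4) (χ : E4 → M),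
      (∀ R', R ≤ R' → IsCompact (K ∪ {x | ‖ψ x‖ ≤ R'})) →
      ContMDiffOn (𝓡 4) 𝓘(ℝ, E4) ∞ ψ Kᶜ →
      ContMDiffOn 𝓘(ℝ, E4) (𝓡 4) ∞ χ (Metric.closedBall (0 : E4) R)ᶜ →
      Set.BijOn ψ Kᶜ (Metric.closedBall (0 : E4) R)ᶜ →
      (∀ x, x ∈ Kᶜ → χ (ψ x) = x) →
      (∀ x, x ∈ Kᶜ → ∀ v w, sf x ![v, w] =
        stdSymplecticForm (mfderiv (𝓡 4) 𝓘(ℝ, E4) ψ x v) (mfderiv (𝓡 4) 𝓘(ℝ, E4) ψ x w)) →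
      ∀ (R₁ : ℝ) (J : AlmostComplexStructure (𝓡 4) ∞ M), R < R₁ → 0 < R₁ → J.IsTamedBy sf →
      (∀ x, x ∈ Kᶜ → R₁ < ‖ψ x‖ → ∀ (v : TangentSpace (𝓡 4) x) (a : E4),
          a = mfderiv (𝓡 4) 𝓘(ℝ, E4) ψ x v →
          mfderiv (𝓡 4) 𝓘(ℝ, E4) ψ x (J x v) = WithLp.toLp 2 ![-(a 1), a 0, -(a 3), a 2]) →
      ∀ σ : M ≃ₘ⟮𝓡 4, 𝓡 4⟯ E4,
        (∀ (x : M) (v : TangentSpace (𝓡 4) x) (a b : E4), a = mfderiv (𝓡 4) 𝓘(ℝ, E4) σ x v →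
            b = mfderiv (𝓡 4) 𝓘(ℝ, E4) σ x (J x v) →
            (a 2 = 0 → a 3 = 0 → b 2 = 0 ∧ b 3 = 0) ∧ (a 0 = 0 → a 1 = 0 → b 0 = 0 ∧ b 1 = 0)) →
        (∀ (x : M) (v : TangentSpace (𝓡 4) x), v ≠ 0 →
            0 < stdSymplecticForm (mfderiv (𝓡 4) 𝓘(ℝ, E4) σ x v)
              (mfderiv (𝓡 4) 𝓘(ℝ, E4) σ x (J x v))) →
        (∀ w : E4, R₁ ^ 2 < w 0 ^ 2 + w 1 ^ 2 → (σ (χ w)) 0 = w 0 ∧ (σ (χ w)) 1 = w 1) →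
        (∀ w : E4, R₁ ^ 2 < w 2 ^ 2 + w 3 ^ 2 → (σ (χ w)) 2 = w 2 ∧ (σ (χ w)) 3 = w 3) →
        (∃ g : E4 → E2, ContDiffOn ℝ ∞ g {p : E4 | p 0 ^ 2 + p 1 ^ 2 < R₁⁻¹ ^ 2} ∧
          (∀ p q : E4, p 0 ^ 2 + p 1 ^ 2 < R₁⁻¹ ^ 2 → (p 0 ≠ 0 ∨ p 1 ≠ 0) →
            q = σ (χ (WithLp.toLp 2
              ![p 0 / (p 0 ^ 2 + p 1 ^ 2), -(p 1) / (p 0 ^ 2 + p 1 ^ 2), p 2, p 3])) →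
            g p = WithLp.toLp 2 ![q 2, q 3]) ∧
          (∀ p : E4, p 0 = 0 → p 1 = 0 → g p = WithLp.toLp 2 ![p 2, p 3])) →
        (∃ h : E4 → E2, ContDiffOn ℝ ∞ h {p : E4 | p 2 ^ 2 + p 3 ^ 2 < R₁⁻¹ ^ 2} ∧
          (∀ p q : E4, p 2 ^ 2 + p 3 ^ 2 < R₁⁻¹ ^ 2 → (p 2 ≠ 0 ∨ p 3 ≠ 0) →
            q = σ (χ (WithLp.toLp 2
              ![p 0, p 1, p 2 / (p 2 ^ 2 + p 3 ^ 2), -(p 3) / (p 2 ^ 2 + p 3 ^ 2)])) →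
            h p = WithLp.toLp 2 ![q 0, q 1]) ∧
          (∀ p : E4, p 2 = 0 → p 3 = 0 → h p = WithLp.toLp 2 ![p 0, p 1])) →
        ∃ (Φ₁ : M ≃ₘ⟮𝓡 4, 𝓡 4⟯ E4) (K₁ : Set M), IsCompact K₁ ∧ K ⊆ K₁ ∧
          (∀ x, x ∉ K₁ → Φ₁ x = ψ x) ∧
          ∀ (x : M) (v : TangentSpace (𝓡 4) x), v ≠ 0 →
            0 < stdSymplecticForm (mfderiv (𝓡 4) 𝓘(ℝ, E4) Φ₁ x v)
              (mfderiv (𝓡 4) 𝓘(ℝ, E4) Φ₁ x (J x v)) := by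
  intro M _ _ _ _ _ _ sf K R ψ χ h5 h6 h7 h8 h9 h10 R₁ J hR₁ hR₁pos hJt hJstd σ hB1 hB2 hB3a hB3b
    hB4 hB5
  obtain ⟨g, hg, hgG, hg0⟩ := hB4
  obtain ⟨h, hh, hhG, hh0⟩ := hB5
  -- Step 0: `K` is compact and closed; `ψ ∘ χ = id` beyond `R`
  have hKψ : ∀ x, x ∉ K → R < ‖ψ x‖ := fun x hx => by
    have hm := h8.mapsTo (show x ∈ Kᶜ from hx)
    simpa [Metric.mem_closedBall, dist_zero_right] using hm
  have hKc : IsCompact K := by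
    have e : K ∪ {x | ‖ψ x‖ ≤ R} = K := by
      refine union_eq_left.2 fun x hx => ?_
      by_contra hxK
      exact (not_le.2 (hKψ x hxK)) hx
    simpa [e] using h5 R le_rfl
  have hKcl : IsClosed K := hKc.isClosed
  have hψχ : ∀ w : E4, R < ‖w‖ → ψ (χ w) = w := fun w hw => by
    obtain ⟨x, hx, rfl⟩ := h8.surjOn (show w ∈ (Metric.closedBall (0 : E4) R)ᶜ by
      simpa [Metric.mem_closedBall, dist_zero_right] using hw)
    rw [h9 x hx]
  -- Step 1: `C¹`-decay of `G = σ ∘ χ`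
  set G : E4 → E4 := fun w => σ (χ w) with hGdef
  obtain ⟨r₀, hr₀, hdec⟩ := decay_of_smooth_at_wedge
    (fun _ _ hg' hgG' hg0' hGa' hGb' => decay_first_factor hR₁pos hg' hgG' hg0' hGa' hGb') (G := G)
    (hg.of_le (by exact_mod_cast le_top)) hgG hg0 (hh.of_le (by exact_mod_cast le_top)) hhG hh0
    hB3a hB3b (1 / 100) (by norm_num)
  set r : ℝ := max r₀ (R₁ + 1) with hr
  have hR₁r : R₁ < r := by linarith [le_max_right r₀ (R₁ + 1)]
  have hRr : R < r := hR₁.trans hR₁r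
  have hdec' : ∀ w : E4, r < ‖w‖ → DifferentiableAt ℝ G w ∧ ‖G w - w‖ ≤ 1 / 100 ∧
      ‖fderiv ℝ G w - ContinuousLinearMap.id ℝ E4‖ ≤ 1 / 100 :=
    fun w hw => hdec w (by linarith [le_max_left r₀ (R₁ + 1)])
  -- Step 2: `W = ψ ∘ σ⁻¹` is smooth on the open set `σ(Kᶜ)`
  set W : E4 → E4 := fun y => ψ (σ.symm y) with hWdef
  set O : Set E4 := σ.symm ⁻¹' Kᶜ with hO
  have hOo : IsOpen O := hKcl.isOpen_compl.preimage σ.symm.continuous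
  have hWs : ContDiffOn ℝ ∞ W O := by
    rw [← contMDiffOn_iff_contDiffOn]
    exact h6.comp σ.symm.contMDiff.contMDiffOn (fun y hy => hy)
  -- Step 3: a ball containing `σ(K ∪ {‖ψ‖ ≤ r})`
  have hSc : IsCompact (σ '' (K ∪ {x | ‖ψ x‖ ≤ r})) := (h5 r hRr.le).image σ.continuous
  obtain ⟨ρ₀, hρ₀pos, hρ₀⟩ : ∃ ρ₀ : ℝ, 0 < ρ₀ ∧ ∀ x, x ∈ K ∪ {x | ‖ψ x‖ ≤ r} → ‖σ x‖ < ρ₀ := by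
    obtain ⟨ρ₀, hρ₀pos, hsub⟩ := hSc.isBounded.subset_ball_lt 0 0
    exact ⟨ρ₀, hρ₀pos, fun x hx => by simpa using hsub (mem_image_of_mem σ hx)⟩
  have hfar : ∀ x : M, ρ₀ ≤ ‖σ x‖ → x ∉ K ∧ r < ‖ψ x‖ := by
    intro x hx
    by_contra hc
    have hx' : x ∈ K ∪ {x | ‖ψ x‖ ≤ r} := by
      rw [not_and_or, not_not, not_lt] at hc
      exact hc.elim Or.inl fun h' => Or.inr h'
    exact absurd hx (not_le.2 (hρ₀ x hx'))
  -- Step 4: the cut-off `θ`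
  obtain ⟨c, hc0, hcut⟩ := exists_radial_cutoff
  set ρ₁ : ℝ := max ρ₀ (max (400 * c) 1) with hρ₁
  have h1ρ₁ : 1 ≤ ρ₁ := (le_max_right _ _).trans (le_max_right _ _)
  have hρ₁0 : 0 < ρ₁ := one_pos.trans_le h1ρ₁
  have hρ₀₁ : ρ₀ ≤ ρ₁ := le_max_left _ _
  have hcρ₁ : 400 * c ≤ ρ₁ := (le_max_left _ _).trans (le_max_right _ _)
  obtain ⟨θ, hθs, hθ0, hθ1, hθle, hθ'⟩ := hcut ρ₁ hρ₁0
  have h4c : 4 * c / ρ₁ ≤ 1 / 100 := by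
    rw [div_le_iff₀ hρ₁0]
    linarith
  -- Step 5: the global map `F = id + θ · (W - id)` on `ℝ⁴`
  set F : E4 → E4 := fun y => y + θ y • (W y - y) with hF
  have hyfar : ∀ y : E4, ρ₀ ≤ ‖y‖ → σ.symm y ∉ K ∧ r < ‖ψ (σ.symm y)‖ := fun y hy =>
    hfar (σ.symm y) (by simpa using hy)
  have hFid : ∀ y : E4, ‖y‖ < ρ₁ → F =ᶠ[𝓝 y] id := fun y hy => by
    filter_upwards [Metric.isOpen_ball.mem_nhds (mem_ball_zero_iff.2 hy)] with y' hy'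
    simp [hF, hθ0 y' (le_of_lt (mem_ball_zero_iff.1 hy'))]
  have hFs : ContDiff ℝ ∞ F := by
    rw [contDiff_iff_contDiffAt]
    intro y
    rcases lt_or_ge ‖y‖ ρ₁ with hy | hy
    · exact contDiffAt_id.congr_of_eventuallyEq (hFid y hy)
    · have hyO : y ∈ O := (hyfar y (hρ₀₁.trans hy)).1
      have hWy : ContDiffAt ℝ ∞ W y := hWs.contDiffAt (hOo.mem_nhds hyO)
      exact contDiffAt_id.add (hθs.contDiffAt.smul (hWy.sub contDiffAt_id))
  -- the estimates far out, read through `w = ψ x`, `y = σ x = G w`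
  have hWfar : ∀ y : E4, ρ₀ ≤ ‖y‖ → ‖W y - y‖ ≤ 1 / 100 ∧ DifferentiableAt ℝ W y ∧
      ‖fderiv ℝ W y - ContinuousLinearMap.id ℝ E4‖ ≤ 2 / 100 := by
    intro y hy
    obtain ⟨hxK, hxr⟩ := hyfar y hy
    have hyO : y ∈ O := hxK
    set w : E4 := ψ (σ.symm y) with hw
    have hGw : G w = y := by
      show σ (χ (ψ (σ.symm y))) = y
      rw [h9 _ hxK, Diffeomorph.apply_symm_apply]
    obtain ⟨hGd, hG0, hGD⟩ := hdec' w hxr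
    have hWd : DifferentiableAt ℝ W y :=
      (hWs.differentiableOn (by simp) y hyO).differentiableAt (hOo.mem_nhds hyO)
    have hW0 : ‖W y - y‖ ≤ 1 / 100 := by
      have : W y - y = -(G w - w) := by rw [hGw, neg_sub]
      rw [this, norm_neg]
      exact hG0
    -- `W ∘ G = id` near `w`, hence `DW(y) ∘ DG(w) = id`
    have hWG : (fderiv ℝ W y).comp (fderiv ℝ G w) = ContinuousLinearMap.id ℝ E4 := by
      have h1 : HasFDerivAt (W ∘ G) ((fderiv ℝ W y).comp (fderiv ℝ G w)) w := by
        have hWd' : DifferentiableAt ℝ W (G w) := by rw [hGw]; exact hWd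
        have := hWd'.hasFDerivAt.comp w hGd.hasFDerivAt
        rwa [hGw] at this
      have h2 : HasFDerivAt (W ∘ G) (ContinuousLinearMap.id ℝ E4) w := by
        refine (hasFDerivAt_id w).congr_of_eventuallyEq ?_
        have hU : IsOpen {w' : E4 | R < ‖w'‖} := isOpen_lt continuous_const continuous_norm
        filter_upwards [hU.mem_nhds (show R < ‖w‖ from hRr.trans hxr)] with w' hw'
        show ψ (σ.symm (σ (χ w'))) = w'
        rw [Diffeomorph.symm_apply_apply, hψχ w' hw']
      exact h1.unique h2
    have hWD : ‖fderiv ℝ W y - ContinuousLinearMap.id ℝ E4‖ ≤ 2 * (1 / 100) :=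
      norm_sub_id_le_of_comp_eq_id hWG hGD (by norm_num)
    exact ⟨hW0, hWd, hWD.trans (by norm_num)⟩
  have hF' : ∀ y : E4, ‖fderiv ℝ F y - ContinuousLinearMap.id ℝ E4‖ ≤ 3 / 100 := by
    intro y
    rcases lt_or_ge ‖y‖ ρ₁ with hy | hy
    · rw [(hFid y hy).fderiv_eq, fderiv_id, sub_self, norm_zero]
      norm_num
    · obtain ⟨hW0, hWd, hWD⟩ := hWfar y (hρ₀₁.trans hy)
      have hθd : DifferentiableAt ℝ θ y := hθs.differentiable (by simp) y
      have hFd : HasFDerivAt F (ContinuousLinearMap.id ℝ E4 +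
          (θ y • (fderiv ℝ W y - ContinuousLinearMap.id ℝ E4) +
            (fderiv ℝ θ y).smulRight (W y - y))) y :=
        (hasFDerivAt_id y).add (hθd.hasFDerivAt.smul (hWd.hasFDerivAt.sub (hasFDerivAt_id y)))
      rw [hFd.fderiv, add_sub_cancel_left]
      calc ‖θ y • (fderiv ℝ W y - ContinuousLinearMap.id ℝ E4) +
            (fderiv ℝ θ y).smulRight (W y - y)‖
          ≤ ‖θ y • (fderiv ℝ W y - ContinuousLinearMap.id ℝ E4)‖ +
            ‖(fderiv ℝ θ y).smulRight (W y - y)‖ := norm_add_le _ _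
        _ = |θ y| * ‖fderiv ℝ W y - ContinuousLinearMap.id ℝ E4‖ +
            ‖fderiv ℝ θ y‖ * ‖W y - y‖ := by
            rw [norm_smul, Real.norm_eq_abs, ContinuousLinearMap.norm_smulRight_apply]
        _ ≤ 1 * (2 / 100) + (4 * c / ρ₁) * (1 / 100) :=
            add_le_add (mul_le_mul (hθle y) hWD (norm_nonneg _) zero_le_one)
              (mul_le_mul (hθ' y) hW0 (norm_nonneg _) (by positivity))
        _ ≤ 3 / 100 := by
            have h5c : 4 * c / ρ₁ * (1 / 100) ≤ 1 / 100 * (1 / 100) :=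
              mul_le_mul_of_nonneg_right h4c (by norm_num)
            linarith only [h5c]
  obtain ⟨Φ, hΦ⟩ := exists_diffeomorph_of_norm_fderiv_sub_id_le (E := E4) (n := ∞) (by simp) hFs
    (fun y => (hF' y).trans (by norm_num))
  -- Step 6: `Φ₁ := Φ ∘ σ`, `K₁ := K ∪ σ⁻¹(closed ball of radius 2ρ₁)`
  refine ⟨σ.trans Φ, K ∪ σ ⁻¹' Metric.closedBall 0 (2 * ρ₁), ?_, subset_union_left, ?_, ?_⟩
  · exact hKc.union (σ.toHomeomorph.isCompact_preimage.2 (isCompact_closedBall _ _))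
  · intro x hx
    rw [mem_union, not_or] at hx
    have hx2 : 2 * ρ₁ ≤ ‖σ x‖ := by
      have := hx.2
      rw [mem_preimage, Metric.mem_closedBall, dist_zero_right, not_le] at this
      exact this.le
    rw [Diffeomorph.coe_trans, Function.comp_apply, hΦ]
    show σ x + θ (σ x) • (W (σ x) - σ x) = ψ x
    rw [hθ1 (σ x) hx2, one_smul, add_sub_cancel]
    show ψ (σ.symm (σ x)) = ψ x
    rw [Diffeomorph.symm_apply_apply]
  · -- tameness of `Φ₁*ω₀`
    intro x v hv
    have hσd : MDifferentiableAt (𝓡 4) (𝓡 4) σ x := σ.contMDiff.mdifferentiableAt (by simp)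
    have hΦd : MDifferentiableAt 𝓘(ℝ, E4) 𝓘(ℝ, E4) Φ (σ x) :=
      Φ.contMDiff.mdifferentiableAt (by simp)
    have hcomp' : mfderiv (𝓡 4) 𝓘(ℝ, E4) (σ.trans Φ) x =
        (mfderiv 𝓘(ℝ, E4) 𝓘(ℝ, E4) Φ (σ x)).comp (mfderiv (𝓡 4) (𝓡 4) σ x) := by
      rw [Diffeomorph.coe_trans]
      exact mfderiv_comp x hΦd hσd
    have hcomp : ∀ u : TangentSpace (𝓡 4) x, mfderiv (𝓡 4) 𝓘(ℝ, E4) (σ.trans Φ) x u =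
        fderiv ℝ F (σ x) (mfderiv (𝓡 4) 𝓘(ℝ, E4) σ x u) := fun u => by
      rw [hcomp', mfderiv_eq_fderiv, hΦ]
      rfl
    rw [hcomp, hcomp]
    rcases lt_or_ge ‖σ x‖ ρ₁ with hlt | hge
    · -- here `F = id` near `σ x`, so `dΦ₁ = dσ` and (B2) applies
      have hFσ : fderiv ℝ F (σ x) = ContinuousLinearMap.id ℝ E4 := by
        rw [(hFid (σ x) hlt).fderiv_eq, fderiv_id]
      rw [hFσ]
      exact hB2 x v hv
    · obtain ⟨hxK, hxr⟩ := hfar x (hρ₀₁.trans hge)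
      -- `σ = G ∘ ψ` near `x`
      have hev : (σ : M → E4) =ᶠ[𝓝 x] (G ∘ ψ) := by
        filter_upwards [hKcl.isOpen_compl.mem_nhds hxK] with x' hx'
        show σ x' = σ (χ (ψ x'))
        rw [h9 x' hx']
      have hψd : MDifferentiableAt (𝓡 4) 𝓘(ℝ, E4) ψ x :=
        (h6.contMDiffAt (hKcl.isOpen_compl.mem_nhds hxK)).mdifferentiableAt (by simp)
      obtain ⟨hGd, -, hGD⟩ := hdec' (ψ x) hxr
      have hGmd : MDifferentiableAt 𝓘(ℝ, E4) 𝓘(ℝ, E4) G (ψ x) :=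
        mdifferentiableAt_iff_differentiableAt.2 hGd
      have hσG' : mfderiv (𝓡 4) 𝓘(ℝ, E4) σ x =
          (mfderiv 𝓘(ℝ, E4) 𝓘(ℝ, E4) G (ψ x)).comp (mfderiv (𝓡 4) 𝓘(ℝ, E4) ψ x) := by
        rw [hev.mfderiv_eq]
        exact mfderiv_comp x hGmd hψd
      have hσG : ∀ u : TangentSpace (𝓡 4) x, mfderiv (𝓡 4) 𝓘(ℝ, E4) σ x u =
          fderiv ℝ G (ψ x) (mfderiv (𝓡 4) 𝓘(ℝ, E4) ψ x u) := fun u => by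
        rw [hσG', mfderiv_eq_fderiv]
        rfl
      set a : E4 := mfderiv (𝓡 4) 𝓘(ℝ, E4) ψ x v with ha
      have hJa : mfderiv (𝓡 4) 𝓘(ℝ, E4) ψ x (J x v) =
          WithLp.toLp 2 ![-(a 1), a 0, -(a 3), a 2] := hJstd x hxK (hR₁r.trans hxr) v a rfl
      have ha0 : a ≠ 0 := by
        intro h0
        have h1 : mfderiv (𝓡 4) 𝓘(ℝ, E4) σ x v = 0 := by
          rw [hσG, ← ha, h0, map_zero]
          rfl
        have hinj := (σ.mfderivToContinuousLinearEquiv (by simp) x).injective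
        have hcoe : ⇑(σ.mfderivToContinuousLinearEquiv (by simp) x) =
            ⇑(mfderiv (𝓡 4) 𝓘(ℝ, E4) σ x) :=
          congrArg DFunLike.coe (σ.mfderivToContinuousLinearEquiv_coe (by simp))
        rw [hcoe] at hinj
        exact hv (hinj (by rw [h1, map_zero]))
      set L : E4 →L[ℝ] E4 := (fderiv ℝ F (σ x)).comp (fderiv ℝ G (ψ x)) with hL
      have hLn : ‖L - ContinuousLinearMap.id ℝ E4‖ ≤ 1 / 20 := by
        refine (norm_comp_sub_id_le _ _).trans ?_
        have h1 := hF' (σ x)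
        have h2 : ‖fderiv ℝ F (σ x) - ContinuousLinearMap.id ℝ E4‖ *
            ‖fderiv ℝ G (ψ x) - ContinuousLinearMap.id ℝ E4‖ ≤ 3 / 100 * (1 / 100) :=
          mul_le_mul h1 hGD (norm_nonneg _) (by norm_num)
        linarith only [h1, hGD, h2]
      rw [hσG, hσG, ← ha, hJa]
      exact stdSymplecticForm_pos_of_norm_sub_id_le L hLn a ha0

end Summit.SmoothPoincare4.SmoothPoincare4.Theorems.GromovRecognitionRelEnd.CrossCapLaurent

end
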